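import Mathlib
import HarnessLib.Audit
import Summits.PneNP.PneNP.Theorems.PstarGateUnit
import Summits.PneNP.PneNP.Theorems.PstarChordBridgePointwise
import Summits.PneNP.PneNP.Theorems.PstarNorUnitBridge

/-!
# The gate unit on bridge data: pin + gate reader ⟹ CONS-T pair (ROUND-24, memo §10.1; O2 pipeline end to end on its first mechanism)

FRONTIER range-avoidance ladder, rung F-N3, ROUND 24 (cell `pnp-ideate`, planner memo `r24/CORE-BOUND-NOTES.md` §10.1 (GATE-READ NOR family),
§10 "non-constant reads"; restricted-model proof complexity — nothing here bears on `P` versus `NP`).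

The O2 pipeline (prover-2 g18 `O1-SCOPING.md` §6, prover-1 g15 `O2-SCOPING.md` §4) on the one mechanism the kit has exhibited outside
privates-unread — the GATE: a chord `e` of well-formed bridge data whose private `p_e` is read through a reader `(p_e, τ)`, in a direction `m`
whose basis-changed constraint is a PIN `q_m = x_σ + κ`.  Ingredients, all in tree:

1. `PstarChordBridgePointwise.forced_of_read_dir` — (★★) pointwise: `Q_{D e} = γ_e + 1` on `Z(q_m) ∩ {e read}`, here on the codimension-two
   flat `{x_σ = κ} ∩ {x_τ = 0}` (the read sheet of the gate);
2. `PstarCubeIdeals.exists_affine_of_codimTwo` — hence `Q_{D e} + γ_e + 1 = (x_σ + κ)·m₁ + x_τ·m₂` with `m₁, m₂` affine: a single-literal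
   NOR certificate;
3. `PstarGateUnit.unit_of_payer` — with the reader as payer: `D e` is a CONS-T pair `{j₁, j₂}`, `σ ∈ j₁`, `τ ∈ j₂`.

`gate_unit_of_dir` packages 1–3: hypotheses are the bridge data (pure typed `(r,3/2)`-expanding, simple overlaps, `B.WF I`, `#(J₀ ∪ G₁ ∪ G₂) ≤ r`,
pendants off `J₀`), infeasibility of the model, reads pointwise on the line of `m ≠ 0`, the pin shape of `q_m`, that `e` is read wherever
`x_τ = 0`, and a pendant `g` with AND pair inside `{σ, τ} ∪ andPair e` (the reader `(p_e, τ)` itself, or a `(σ,τ)` gadget).  No constancy of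
reads, no chord-minimality, no privates-unread.
-/

set_option linter.dupNamespace false -- `Summit.PneNP.PneNP.…`: summit = sub-problem name (D-0017 single-conjunct layout)

open Finset Module Literature.Computability.Complexity
open Summit.PneNP.PneNP.Theorems.PstarTyped (Typed)
open Summit.PneNP.PneNP.Theorems.PstarSALevel (varSet bdry BoundaryExpanding SimpleOverlap)
open Summit.PneNP.PneNP.Theorems.PstarGapLinearised (andPair andPair_subset_varSet)
open Summit.PneNP.PneNP.Theorems.PstarGapPeeling (not_mem_varSet_of_private)
open Summit.PneNP.PneNP.Theorems.PstarCubeIdeals (IsAffineFn IsQuadFn isAffineFn_of_linear exists_affine_of_codimTwo)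
open Summit.PneNP.PneNP.Theorems.PstarRankRigidityTwo (linPart linPart_apply)
open Summit.PneNP.PneNP.Theorems.PstarProductRank (qform polar)
open Summit.PneNP.PneNP.Theorems.PstarReadSumset (V2)
open Summit.PneNP.PneNP.Theorems.PstarChordSystem (ChordSystem)
open Summit.PneNP.PneNP.Theorems.PstarChordBridgeTools
open Summit.PneNP.PneNP.Theorems.PstarChordBridge
open Summit.PneNP.PneNP.Theorems.PstarChordBridgeForcing (gam qform_add' rank_four_of_wf)
open Summit.PneNP.PneNP.Theorems.PstarChordBridgeBasis (qDir)
open Summit.PneNP.PneNP.Theorems.PstarChordBridgePointwise (forced_of_read_dir)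
open Summit.PneNP.PneNP.Theorems.PstarNorUnitBridge (xor_not_mem_bdry_of_even)
open Summit.PneNP.PneNP.Theorems.PstarGateUnit (unit_of_payer)

namespace Summit.PneNP.PneNP.Theorems.PstarGateUnitBridge

variable {n m : ℕ}

/-- The coordinate function `x ↦ x σ + κ` is affine. -/
theorem isAffineFn_coord (σ : Fin n) (κ : ZMod 2) : IsAffineFn (fun x : Fin n → ZMod 2 => x σ + κ) := by
  intro x w
  have key : ∀ a b k : ZMod 2, a + b + k = a + k + (b + k) + (0 + k) := by decide
  simp only [Pi.add_apply, Pi.zero_apply]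
  exact key _ _ _

/-- The coordinate function `x ↦ x τ` is affine. -/
theorem isAffineFn_coord' (τ : Fin n) : IsAffineFn (fun x : Fin n → ZMod 2 => x τ) :=
  fun x w => by simp only [Pi.add_apply, Pi.zero_apply, add_zero]

/-- The linear part of `x ↦ x σ + κ` at a basis vector. -/
theorem linPart_coord (σ : Fin n) (κ : ZMod 2) (v : Fin n) :
    linPart (isAffineFn_coord σ κ) (Pi.single v (1 : ZMod 2)) = if v = σ then 1 else 0 := by
  rw [linPart_apply]
  simp only [Pi.single_apply, Pi.zero_apply, zero_add]
  by_cases h : σ = v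
  · rw [if_pos h, if_pos h.symm]; generalize κ = k; revert k; decide
  · rw [if_neg h, if_neg (fun h' => h h'.symm)]; generalize κ = k; revert k; decide

/-- The linear part of `x ↦ x τ` at a basis vector. -/
theorem linPart_coord' (τ : Fin n) (v : Fin n) :
    linPart (isAffineFn_coord' τ) (Pi.single v (1 : ZMod 2)) = if v = τ then 1 else 0 := by
  rw [linPart_apply]
  simp only [Pi.single_apply, Pi.zero_apply, add_zero]
  by_cases h : τ = v
  · rw [if_pos h, if_pos h.symm]
  · rw [if_neg h, if_neg (fun h' => h h'.symm)]

/-- **The gate unit on bridge data.**  See the module docstring. -/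
theorem gate_unit_of_dir (I : LocalMap 4 n m) (hI : I.IsPure xorAndPred) (hT : Typed I) (hS : SimpleOverlap I) {r : ℕ}
    (hB : BoundaryExpanding r I) {B : BridgeData n m} (hW : B.WF I) (hr : (B.J₀ ∪ B.G₁ ∪ B.G₂).card ≤ r)
    (hG₁ : Disjoint B.G₁ B.J₀) (hG₂ : Disjoint B.G₂ B.J₀) (hinf : (sys I B).Infeasible B.N) {mv : V2} (hm : mv ≠ 0)
    (hU1 : ∀ e a, ((sys I B).ρ e a = 0 ∨ (sys I B).ρ e a = mv) ∧ ((sys I B).ρ' e a = 0 ∨ (sys I B).ρ' e a = mv))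
    {e : Fin m} (he : e ∈ B.N) {σ τ : Fin n} (hστ : σ ≠ τ) {κ : ZMod 2} (hq : ∀ x, qDir I B mv x = x σ + κ)
    (hread : ∀ x : Fin n → ZMod 2, x τ = 0 → (sys I B).ρ e x ≠ 0 ∨ (sys I B).ρ' e x ≠ 0)
    {g : Fin m} (hg : g ∈ B.G₁ ∪ B.G₂) (hgv : ∀ v ∈ andPair I g, v = σ ∨ v = τ ∨ v ∈ andPair I e) :
    ∃ j₁ j₂ : Fin m, j₁ ≠ j₂ ∧ B.D e = {j₁, j₂} ∧ Disjoint (andPair I j₁) (andPair I j₂) ∧ σ ∈ andPair I j₁ ∧ τ ∈ andPair I j₂ := by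
  classical
  have heD : e ∉ B.D e := fun h => (mem_sdiff.1 (hW.hD e he h)).2 he
  have hJr : B.J₀.card ≤ r := (card_le_card (subset_union_left.trans subset_union_left)).trans hr
  -- (1) the chord form is forced on the read sheet of the pin
  have hZ : ∀ x : Fin n → ZMod 2, x σ + κ = 0 → x τ = 0 →
      qform (B.D e) (fun j => I.vars j 2) (fun j => I.vars j 3) x + (gam B e + 1) = 0 := by
    intro x hσ hτ
    have h := forced_of_read_dir I B hinf hm hU1 he (by rw [hq, hσ]) (hread x hτ)
    rw [h]; generalize gam B e = t; revert t; decide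
  -- (2) ideal membership on the flat `{x_σ = κ, x_τ = 0}` (dual directions `e_σ`, `e_τ`)
  have hquad : IsQuadFn (fun x => qform (B.D e) (fun j => I.vars j 2) (fun j => I.vars j 3) x + (gam B e + 1)) := by
    refine ⟨polar (B.D e) (fun j => I.vars j 2) (fun j => I.vars j 3), fun x w => ?_⟩
    dsimp only
    rw [qform_add' I (B.D e)]
    generalize qform (B.D e) (fun j => I.vars j 2) (fun j => I.vars j 3) x = a
    generalize qform (B.D e) (fun j => I.vars j 2) (fun j => I.vars j 3) w = b
    generalize qform (B.D e) (fun j => I.vars j 2) (fun j => I.vars j 3) (0 : Fin n → ZMod 2) = c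
    generalize polar (B.D e) (fun j => I.vars j 2) (fun j => I.vars j 3) x w = d
    generalize gam B e = t
    revert a b c d t; decide
  have single_ne : ∀ {a b : Fin n}, a ≠ b → (Pi.single a (1 : ZMod 2) : Fin n → ZMod 2) b = 0 := fun h => Pi.single_eq_of_ne (Ne.symm h) _
  have h₁₁ : ∀ x : Fin n → ZMod 2, (x + (Pi.single σ (1 : ZMod 2) : Fin n → ZMod 2)) σ + κ = x σ + κ + 1 := fun x => by
    rw [Pi.add_apply, Pi.single_eq_same]; ring
  have h₂₁ : ∀ x : Fin n → ZMod 2, (x + (Pi.single σ (1 : ZMod 2) : Fin n → ZMod 2)) τ = x τ := fun x => by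
    rw [Pi.add_apply, single_ne hστ, add_zero]
  have h₁₂ : ∀ x : Fin n → ZMod 2, (x + (Pi.single τ (1 : ZMod 2) : Fin n → ZMod 2)) σ + κ = x σ + κ := fun x => by
    rw [Pi.add_apply, single_ne (Ne.symm hστ), add_zero]
  have h₂₂ : ∀ x : Fin n → ZMod 2, (x + (Pi.single τ (1 : ZMod 2) : Fin n → ZMod 2)) τ = x τ + 1 := fun x => by
    rw [Pi.add_apply, Pi.single_eq_same]
  obtain ⟨m₁, m₂, hm₁, hm₂, hQ⟩ := exists_affine_of_codimTwo (f := fun x => qform (B.D e) (fun j => I.vars j 2) (fun j => I.vars j 3) x + (gam B e + 1))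
    (l₁ := fun x : Fin n → ZMod 2 => x σ + κ) (l₂ := fun x : Fin n → ZMod 2 => x τ) h₁₁ h₂₁ h₁₂ h₂₂ hquad hZ (isAffineFn_coord' τ)
  -- (3) the single-literal unit theorem with the reader as payer
  have hgJ : g ∉ B.J₀ := fun h => by
    rcases mem_union.1 hg with hg' | hg'
    · exact disjoint_left.1 hG₁ hg' h
    · exact disjoint_left.1 hG₂ hg' h
  have hDJ : insert e (B.D e) ⊆ B.J₀ := insert_subset (hW.hN he) ((hW.hD e he).trans sdiff_subset)
  have hgX : g ∉ insert e (B.D e) := fun h => hgJ (hDJ h)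
  have hrX : (insert g (insert e (B.D e))).card ≤ r := by
    refine le_trans (card_le_card ?_) hr
    refine insert_subset ?_ (hDJ.trans (subset_union_left.trans subset_union_left))
    rcases mem_union.1 hg with hg' | hg'
    · exact mem_union_left _ (mem_union_right _ hg')
    · exact mem_union_right _ hg'
  have hpriv : ∀ j ∈ B.D e, ∀ v ∈ andPair I e, v ∉ varSet I j := by
    intro j hj v hv
    have hjJ : j ∈ B.J₀ := (mem_sdiff.1 (hW.hD e he hj)).1
    have hne : j ≠ e := fun h => heD (h ▸ hj)
    obtain ⟨hc2, hc3⟩ := hW.hchord e he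
    rcases (PstarChordEndgameTools.mem_andPair_iff I e v).1 hv with rfl | rfl
    · exact not_mem_varSet_of_private I (hW.hN he) hjJ hne hc2 (PstarCentreFree.vars_mem_varSet I e 2)
    · exact not_mem_varSet_of_private I (hW.hN he) hjJ hne hc3 (PstarCentreFree.vars_mem_varSet I e 3)
  exact unit_of_payer I hI hT hS hB heD (xor_not_mem_bdry_of_even I hI (hW.hDeven e he)) hpriv (isAffineFn_coord σ κ)
    (isAffineFn_coord' τ) hm₁ hm₂ (c := gam B e + 1) hQ hστ (linPart_coord σ κ) (linPart_coord' τ)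
    (rank_four_of_wf I hI hS hB hW hJr he) hgX hgv hrX

end Summit.PneNP.PneNP.Theorems.PstarGateUnitBridge
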